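import Literature.NumberTheory.LFunctions.WeilArchimedeanMoments
import Literature.NumberTheory.LFunctions.WeilArchimedeanPositivityProofs
import Literature.NumberTheory.LFunctions.RiemannSiegelStirling
import Literature.Analysis.SpecialFunctions.DigammaVerticalSeries

/-!
# Stub `stub_archBathtub` of line `Sketch`, crux `WeilComb.CombShapePositivity` — siege attempt k2
(item stmt-RiemannHypothesis-11229, route route-RiemannHypothesis-WeilComb; variation: EXPLICIT
MONOTONE COMPARISON OF THE ARCH TERM)

For a Weil test `g` with `L = ‖g‖₁ > 0` (`weilNorm1`), `N = ‖g‖₂²` (`weilNorm2Sq`) and `2L² ≤ πN`: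

`Re W_∞(g ⋆ g̃) ≥ N (log(N/(2L²)) − 1) − L²  ≥  N (log(N/(2L²)) − 1) − (21/(5π)) L²`

(`archBathtub_sharp`, `stub_archBathtub`; the junk constant `1` improves the registered `21/(5π)`).

Proof — three monotone comparisons, all explicit:

* the arch term is `Re W_∞(g ⋆ g̃) = (1/2π) ∫ G ρ − N log π` with `G(u) = |ĝ(1/2+iu)|²`,
  `ρ(u) = Re ψ(1/4 + iu/2)` (`weilArchIntegral_weilConv_weilReflect`);
* **bathtub** (`bathtub`): `0 ≤ G ≤ L²`, `∫ G = 2πN = L² · 2T` (`T = πN/L²`) and `ρ` increasing in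
  `|u|` (`reDigammaQuarter_mono`) give the pointwise comparison
  `L² 1_{(−T,T]} (ρ − ρ(T)) + ρ(T) G ≤ G ρ`, which integrates to `L² ∫_{−T}^{T} ρ ≤ ∫ G ρ`;
* `∫_{−T}^{T} ρ = 4 arg Γ(¼ + iT/2)` (`argGammaVert`, evenness and `u = 2v`), and the
  **monotone comparison of the arch primitive** (`monotoneOn_argGammaVert_comparison`):
  `D(τ) = arg Γ(¼+iτ) − (τ log τ − τ) − K(¼)/τ` is nondecreasing on `[1, ∞)`, because
  `D'(τ) = (Re ψ(¼+iτ) − log τ) + K(¼)/τ² ≥ 0` by the tree's second-order Stirling bound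
  `|Re ψ(¼+iτ) − log τ| ≤ K(¼)/τ²` (`abs_re_digamma_vertical_sub_log_le`,
  `K(¼) = stirlingVertRate ¼ = 1/6 + π/12 + 1/32 + 1/8`); hence for `τ ≥ 1`
  `arg Γ(¼+iτ) ≥ τ log τ − τ + (arg Γ(¼+i) + 1 − K(¼))`;
* the **base value** `arg Γ(¼ + i) = ∫₀¹ Re ψ(¼ + iv) dv ≥ −23/12` by the lower staircase of the
  increasing weight at `v = 0, ¼, ½, ¾` (`stair_cell`), each node bounded below by a partial sum of
  Yoshida's vertical series (`sum_digammaTerm_le`) and `ψ(¼) ≥ −4.22745354`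
  (`re_digamma_one_quarter_ge`); with `π > 3.14` this gives `arg Γ(¼+iτ) ≥ τ log τ − τ − π/2`,
  i.e. `∫_{−T}^{T} ρ ≥ 2T(log(T/2) − 1) − 2π` for `T ≥ 2`;
* assembly: `(1/2π) L² (2T(log(T/2) − 1) − 2π) − N log π = N(log(N/(2L²)) − 1) − L²` at
  `T = πN/L² ≥ 2`.
-/

noncomputable section

-- the sub-problem path RiemannHypothesis/RiemannHypothesis duplicates a namespace (D-0017)
set_option linter.dupNamespace false

open Complex MeasureTheory Set

namespace Summit.RiemannHypothesis.RiemannHypothesis.Theorems.WeilCombBohrFejerMonotoneK2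

open Literature.NumberTheory.LFunctions
open Literature.Analysis.SpecialFunctions (reDigammaQuarter reDigammaQuarter_even
  reDigammaQuarter_mono continuous_reDigammaQuarter digammaTerm digammaNode sum_digammaTerm_le
  reDigammaQuarter_zero re_digamma_one_quarter_ge)

/-! ### Monotone comparison for `arg Γ` on the line `Re s = 1/4` -/

/-- **Monotone comparison of the arch primitive.** The function
`D(τ) = arg Γ(¼+iτ) − (τ log τ − τ) − K(¼) τ⁻¹` is nondecreasing on `[1, ∞)`:
`D'(τ) = (Re ψ(¼+iτ) − log τ) + K(¼)/τ² ≥ 0` by `|Re ψ(¼+iτ) − log τ| ≤ K(¼)/τ²`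
(`abs_re_digamma_vertical_sub_log_le`). [folklore] -/
theorem monotoneOn_argGammaVert_comparison :
    MonotoneOn (fun τ : ℝ ↦ argGammaVert (1 / 4) τ - (τ * Real.log τ - τ) -
      stirlingVertRate (1 / 4) * τ⁻¹) (Ici 1) := by
  have hσ : (0 : ℝ) < 1 / 4 := by norm_num
  -- the derivative at every `τ > 0`
  have hderiv : ∀ τ : ℝ, 0 < τ →
      HasDerivAt (fun τ : ℝ ↦ argGammaVert (1 / 4) τ - (τ * Real.log τ - τ) -
          stirlingVertRate (1 / 4) * τ⁻¹)
        ((digamma ((1 / 4 : ℝ) + τ * I)).re - Real.log τ + stirlingVertRate (1 / 4) / τ ^ 2)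
        τ := by
    intro τ hτ
    have h1 := hasDerivAt_argGammaVert_sub hσ hτ
    have h2 : HasDerivAt (fun τ : ℝ ↦ stirlingVertRate (1 / 4) * τ⁻¹)
        (stirlingVertRate (1 / 4) * (-(τ ^ 2)⁻¹)) τ :=
      (hasDerivAt_inv hτ.ne').const_mul _
    exact (h1.sub h2).congr_deriv (by ring)
  refine monotoneOn_of_hasDerivWithinAt_nonneg
    (f' := fun τ ↦ (digamma ((1 / 4 : ℝ) + τ * I)).re - Real.log τ +
      stirlingVertRate (1 / 4) / τ ^ 2) (convex_Ici 1) ?_ ?_ ?_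
  · intro τ hτ
    exact (hderiv τ (by linarith [mem_Ici.1 hτ])).continuousAt.continuousWithinAt
  · intro τ hτ
    rw [interior_Ici] at hτ
    exact (hderiv τ (by linarith [mem_Ioi.1 hτ])).hasDerivWithinAt
  · intro τ hτ
    rw [interior_Ici] at hτ
    have hτ1 : 1 ≤ τ := le_of_lt hτ
    have h := (abs_le.1 (abs_re_digamma_vertical_sub_log_le hσ hτ1)).1
    show 0 ≤ (digamma ((1 / 4 : ℝ) + τ * I)).re - Real.log τ + stirlingVertRate (1 / 4) / τ ^ 2
    linarith

/-- For `τ ≥ 1`: `arg Γ(¼+iτ) ≥ τ log τ − τ + (arg Γ(¼+i) + 1 − K(¼))` (the monotone comparison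
`D(1) ≤ D(τ)`, dropping `K(¼)/τ ≥ 0`). [folklore] -/
theorem argGammaVert_quarter_ge {τ : ℝ} (hτ : 1 ≤ τ) :
    τ * Real.log τ - τ + (argGammaVert (1 / 4) 1 + 1 - stirlingVertRate (1 / 4)) ≤
      argGammaVert (1 / 4) τ := by
  have hmono := monotoneOn_argGammaVert_comparison self_mem_Ici (mem_Ici.2 hτ) hτ
  simp only [Real.log_one, mul_zero, zero_sub, inv_one, mul_one] at hmono
  have hK0 : 0 ≤ stirlingVertRate (1 / 4) := by rw [stirlingVertRate]; positivity
  have hKτ : 0 ≤ stirlingVertRate (1 / 4) * τ⁻¹ := mul_nonneg hK0 (inv_nonneg.2 (by linarith))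
  linarith

/-! ### The base value `arg Γ(¼ + i)` by the lower staircase of the increasing weight -/

/-- `Re ψ(¼ + iv) = ρ(2v)` with `ρ(t) = Re ψ(1/4 + it/2)` (`reDigammaQuarter`). [folklore] -/
theorem re_digamma_quarter_eq (v : ℝ) :
    (digamma ((1 / 4 : ℝ) + v * I)).re = reDigammaQuarter (2 * v) := by
  simp only [reDigammaQuarter]
  push_cast
  ring_nf

/-- Node bound: `ψ(¼) + Σ_{m<M} f_{l_m}(2a) ≤ Re ψ(¼ + ia)` (partial sums of Yoshida's vertical
series, `sum_digammaTerm_le`). [folklore] -/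
theorem node_bound (a : ℝ) (M : ℕ) :
    reDigammaQuarter 0 + ∑ m ∈ Finset.range M, digammaTerm (digammaNode m) (2 * a) ≤
      (digamma ((1 / 4 : ℝ) + a * I)).re := by
  rw [re_digamma_quarter_eq]
  exact sum_digammaTerm_le M (2 * a)

/-- Staircase cell: for `0 ≤ a ≤ b`, `(b − a) Re ψ(¼ + ia) ≤ ∫ₐᵇ Re ψ(¼ + iv) dv`, since the
weight is increasing in `v ≥ 0` (`reDigammaQuarter_mono`). [folklore] -/
theorem stair_cell {a b : ℝ} (ha : 0 ≤ a) (hab : a ≤ b) :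
    (b - a) * (digamma ((1 / 4 : ℝ) + a * I)).re ≤
      ∫ v in a..b, (digamma ((1 / 4 : ℝ) + v * I)).re := by
  have hc : Continuous fun v : ℝ ↦ (digamma ((1 / 4 : ℝ) + v * I)).re :=
    continuous_re_digamma_vertical (by norm_num)
  have hmono : ∀ v ∈ Icc a b,
      (digamma ((1 / 4 : ℝ) + a * I)).re ≤ (digamma ((1 / 4 : ℝ) + v * I)).re := by
    intro v hv
    rw [re_digamma_quarter_eq, re_digamma_quarter_eq]
    refine reDigammaQuarter_mono ?_
    rw [abs_of_nonneg (by linarith), abs_of_nonneg (by linarith [hv.1])]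
    linarith [hv.1]
  calc (b - a) * (digamma ((1 / 4 : ℝ) + a * I)).re
        = ∫ _ in a..b, (digamma ((1 / 4 : ℝ) + a * I)).re := by
        rw [intervalIntegral.integral_const, smul_eq_mul]
    _ ≤ ∫ v in a..b, (digamma ((1 / 4 : ℝ) + v * I)).re :=
        intervalIntegral.integral_mono_on hab intervalIntegrable_const (hc.intervalIntegrable _ _)
          hmono

/-- **Base value.** `arg Γ(¼ + i) = ∫₀¹ Re ψ(¼ + iv) dv ≥ −23/12`: lower staircase at
`v = 0, ¼, ½, ¾` with the node bounds `ψ(¼) ≥ −4.22745354` (`re_digamma_one_quarter_ge`) and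
`ρ(½) − ψ(¼) ≥ 830984/407745`, `ρ(1) − ψ(¼) ≥ 166565056/49894065`,
`ρ(3/2) − ψ(¼) ≥ 685384/177021` (four terms of the vertical series each). [folklore] -/
theorem argGammaVert_quarter_one_ge : -(23 / 12 : ℝ) ≤ argGammaVert (1 / 4) 1 := by
  have hc : Continuous fun v : ℝ ↦ (digamma ((1 / 4 : ℝ) + v * I)).re :=
    continuous_re_digamma_vertical (by norm_num)
  have hint : ∀ a b : ℝ,
      IntervalIntegrable (fun v : ℝ ↦ (digamma ((1 / 4 : ℝ) + v * I)).re) volume a b :=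
    fun a b ↦ hc.intervalIntegrable a b
  have hsplit : argGammaVert (1 / 4) 1 =
      (∫ v in (0 : ℝ)..1 / 4, (digamma ((1 / 4 : ℝ) + v * I)).re) +
      (∫ v in (1 / 4 : ℝ)..1 / 2, (digamma ((1 / 4 : ℝ) + v * I)).re) +
      (∫ v in (1 / 2 : ℝ)..3 / 4, (digamma ((1 / 4 : ℝ) + v * I)).re) +
      (∫ v in (3 / 4 : ℝ)..1, (digamma ((1 / 4 : ℝ) + v * I)).re) := by
    rw [argGammaVert, ← intervalIntegral.integral_add_adjacent_intervals (hint 0 (1 / 4))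
        (hint (1 / 4) 1), ← intervalIntegral.integral_add_adjacent_intervals (hint (1 / 4) (1 / 2))
        (hint (1 / 2) 1), ← intervalIntegral.integral_add_adjacent_intervals
        (hint (1 / 2) (3 / 4)) (hint (3 / 4) 1)]
    ring
  have c0 := stair_cell (a := 0) (b := 1 / 4) le_rfl (by norm_num)
  have c1 := stair_cell (a := 1 / 4) (b := 1 / 2) (by norm_num) (by norm_num)
  have c2 := stair_cell (a := 1 / 2) (b := 3 / 4) (by norm_num) (by norm_num)
  have c3 := stair_cell (a := 3 / 4) (b := 1) (by norm_num) (by norm_num)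
  have v0 : reDigammaQuarter 0 ≤ (digamma ((1 / 4 : ℝ) + (0 : ℝ) * I)).re := by
    have h := node_bound 0 0
    rwa [Finset.sum_range_zero, add_zero] at h
  have v1 : reDigammaQuarter 0 + 830984 / 407745 ≤
      (digamma ((1 / 4 : ℝ) + (1 / 4 : ℝ) * I)).re := by
    have h := node_bound (1 / 4) 4
    have e : ∑ m ∈ Finset.range 4, digammaTerm (digammaNode m) (2 * (1 / 4 : ℝ)) =
        830984 / 407745 := by
      simp only [Finset.sum_range_succ, Finset.sum_range_zero, digammaTerm, digammaNode]
      norm_num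
    linarith
  have v2 : reDigammaQuarter 0 + 166565056 / 49894065 ≤
      (digamma ((1 / 4 : ℝ) + (1 / 2 : ℝ) * I)).re := by
    have h := node_bound (1 / 2) 4
    have e : ∑ m ∈ Finset.range 4, digammaTerm (digammaNode m) (2 * (1 / 2 : ℝ)) =
        166565056 / 49894065 := by
      simp only [Finset.sum_range_succ, Finset.sum_range_zero, digammaTerm, digammaNode]
      norm_num
    linarith
  have v3 : reDigammaQuarter 0 + 685384 / 177021 ≤
      (digamma ((1 / 4 : ℝ) + (3 / 4 : ℝ) * I)).re := by
    have h := node_bound (3 / 4) 4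
    have e : ∑ m ∈ Finset.range 4, digammaTerm (digammaNode m) (2 * (3 / 4 : ℝ)) =
        685384 / 177021 := by
      simp only [Finset.sum_range_succ, Finset.sum_range_zero, digammaTerm, digammaNode]
      norm_num
    linarith
  have h0 : (-4.22745354 : ℝ) ≤ reDigammaQuarter 0 := by
    rw [reDigammaQuarter_zero]
    exact re_digamma_one_quarter_ge
  rw [hsplit]
  linarith

/-! ### The digamma integral `∫_{-T}^{T} Re ψ(1/4 + iu/2) du` -/

/-- `∫_{-T}^{T} ρ(u) du = 4 · arg Γ(¼ + iT/2)`: the weight is even (`reDigammaQuarter_even`) and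
`u = 2v` (`argGammaVert ¼ τ = ∫₀^τ Re ψ(¼ + iv) dv`). [folklore] -/
theorem integral_reDigammaQuarter_eq_four_mul (T : ℝ) :
    ∫ u in (-T)..T, reDigammaQuarter u = 4 * argGammaVert (1 / 4) (T / 2) := by
  have hc : Continuous reDigammaQuarter := continuous_reDigammaQuarter
  have h1 : ∫ u in (-T)..0, reDigammaQuarter u = ∫ u in (0 : ℝ)..T, reDigammaQuarter u := by
    have h := intervalIntegral.integral_comp_neg reDigammaQuarter (a := 0) (b := T)
    simp only [neg_zero, reDigammaQuarter_even] at h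
    exact h.symm
  have h2 : ∫ u in (0 : ℝ)..T, reDigammaQuarter u = 2 * argGammaVert (1 / 4) (T / 2) := by
    have h := intervalIntegral.integral_comp_mul_left reDigammaQuarter (a := 0) (b := T / 2)
      two_ne_zero
    have e : (2 : ℝ) * (T / 2) = T := by ring
    rw [mul_zero, e, smul_eq_mul] at h
    unfold argGammaVert
    simp_rw [re_digamma_quarter_eq]
    rw [h]
    ring
  rw [← intervalIntegral.integral_add_adjacent_intervals (hc.intervalIntegrable (-T) 0)
    (hc.intervalIntegrable 0 T), h1, h2]
  ring

/-- **The explicit digamma integral bound.** For `T ≥ 2`: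
`∫_{-T}^{T} Re ψ(1/4 + iu/2) du ≥ 2T (log(T/2) − 1) − 2π` (monotone comparison from `τ = T/2 ≥ 1`
down to the base value at `τ = 1`; `4(K(¼) − 1 + 23/12) ≤ 2π` as `π > 3.14`). [folklore] -/
theorem integral_reDigammaQuarter_ge {T : ℝ} (hT : 2 ≤ T) :
    2 * T * (Real.log (T / 2) - 1) - 2 * Real.pi ≤ ∫ u in (-T)..T, reDigammaQuarter u := by
  rw [integral_reDigammaQuarter_eq_four_mul]
  have hτ : 1 ≤ T / 2 := by linarith
  have h := argGammaVert_quarter_ge hτ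
  have hA := argGammaVert_quarter_one_ge
  have hK : stirlingVertRate (1 / 4) = 1 / 6 + Real.pi / 12 + 1 / 32 + 1 / 8 := by
    rw [stirlingVertRate]; norm_num
  have hpi := Real.pi_gt_d2
  rw [hK] at h
  linarith

/-! ### The bathtub rearrangement -/

/-- **Bathtub comparison.** For a Weil test `g` with `L = ‖g‖₁`, `N = ‖g‖₂²` and `T ≥ 0` with
`L² T = πN`: `L² ∫_{-T}^{T} ρ ≤ ∫ |ĝ(1/2+iu)|² ρ(u) du`. With `G = |ĝ(1/2+i·)|²` one has
`0 ≤ G ≤ L²` (`norm_weilMellin_half_line_le`), `∫ G = 2πN = 2T L²` (Plancherel,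
`integral_norm_sq_weilMellin_half_line`) and `ρ` increasing in `|u|` (`reDigammaQuarter_mono`),
whence the pointwise comparison `L² 1_{(−T,T]}(ρ − ρ(T)) + ρ(T) G ≤ G ρ`; integrate. [folklore] -/
theorem bathtub {g : ℝ → ℂ} (hg : IsWeilTest g) {T : ℝ} (hT0 : 0 ≤ T)
    (hT : weilNorm1 g ^ 2 * T = Real.pi * weilNorm2Sq g) :
    weilNorm1 g ^ 2 * ∫ u in (-T)..T, reDigammaQuarter u ≤
      ∫ u : ℝ, ‖weilMellin g (1 / 2 + u * I)‖ ^ 2 * reDigammaQuarter u := by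
  have hGi : Integrable fun u : ℝ ↦ ‖weilMellin g (1 / 2 + u * I)‖ ^ 2 :=
    integrable_norm_sq_weilMellin_half_line hg
  have hGρi : Integrable fun u : ℝ ↦ ‖weilMellin g (1 / 2 + u * I)‖ ^ 2 * reDigammaQuarter u :=
    integrable_norm_sq_weilMellin_mul_reDigammaQuarter hg
  have hPl : ∫ u : ℝ, ‖weilMellin g (1 / 2 + u * I)‖ ^ 2 = 2 * Real.pi * weilNorm2Sq g :=
    integral_norm_sq_weilMellin_half_line hg
  have hGL : ∀ u : ℝ, ‖weilMellin g (1 / 2 + u * I)‖ ^ 2 ≤ weilNorm1 g ^ 2 := fun u ↦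
    pow_le_pow_left₀ (norm_nonneg _) (norm_weilMellin_half_line_le hg u) 2
  have hTT : -T ≤ T := by linarith
  -- the truncation defect `k = 1_{(−T,T]} (ρ − ρ(T))`, integrable with
  -- `∫ k = ∫_{−T}^{T} ρ − 2T ρ(T)`
  have hki : Integrable
      ((Ioc (-T) T).indicator fun u ↦ reDigammaQuarter u - reDigammaQuarter T) := by
    have h : IntervalIntegrable (fun u ↦ reDigammaQuarter u - reDigammaQuarter T) volume (-T) T :=
      (continuous_reDigammaQuarter.sub continuous_const).intervalIntegrable _ _
    exact h.1.integrable_indicator measurableSet_Ioc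
  have hkint : ∫ u, (Ioc (-T) T).indicator (fun u ↦ reDigammaQuarter u - reDigammaQuarter T) u =
      (∫ u in (-T)..T, reDigammaQuarter u) - 2 * T * reDigammaQuarter T := by
    rw [integral_indicator measurableSet_Ioc, ← intervalIntegral.integral_of_le hTT,
      intervalIntegral.integral_sub (continuous_reDigammaQuarter.intervalIntegrable _ _)
        intervalIntegrable_const, intervalIntegral.integral_const, smul_eq_mul]
    ring
  -- the pointwise comparison
  have hpt : ∀ u : ℝ,
      weilNorm1 g ^ 2 *
          (Ioc (-T) T).indicator (fun u ↦ reDigammaQuarter u - reDigammaQuarter T) u +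
        reDigammaQuarter T * ‖weilMellin g (1 / 2 + u * I)‖ ^ 2 ≤
      ‖weilMellin g (1 / 2 + u * I)‖ ^ 2 * reDigammaQuarter u := by
    intro u
    by_cases hu : u ∈ Ioc (-T) T
    · rw [indicator_of_mem hu]
      have hρu : reDigammaQuarter u ≤ reDigammaQuarter T := by
        refine reDigammaQuarter_mono ?_
        rw [abs_of_nonneg hT0]
        exact abs_le.2 ⟨by linarith [hu.1], hu.2⟩
      nlinarith [mul_nonneg (sub_nonneg.2 (hGL u)) (sub_nonneg.2 hρu)]
    · rw [indicator_of_notMem hu, mul_zero, zero_add, mul_comm]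
      have hρu : reDigammaQuarter T ≤ reDigammaQuarter u := by
        refine reDigammaQuarter_mono ?_
        rw [abs_of_nonneg hT0]
        simp only [mem_Ioc, not_and_or, not_lt, not_le] at hu
        rcases hu with h | h
        · linarith [neg_le_abs u]
        · linarith [le_abs_self u]
      exact mul_le_mul_of_nonneg_left hρu (by positivity)
  -- integrate
  have hlhs : Integrable fun u : ℝ ↦
      weilNorm1 g ^ 2 *
          (Ioc (-T) T).indicator (fun u ↦ reDigammaQuarter u - reDigammaQuarter T) u +
        reDigammaQuarter T * ‖weilMellin g (1 / 2 + u * I)‖ ^ 2 :=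
    (hki.const_mul _).add (hGi.const_mul _)
  have hmono := integral_mono hlhs hGρi hpt
  rw [integral_add (hki.const_mul _) (hGi.const_mul _), integral_const_mul, integral_const_mul,
    hkint, hPl] at hmono
  have e : weilNorm1 g ^ 2 * (2 * T * reDigammaQuarter T) =
      reDigammaQuarter T * (2 * Real.pi * weilNorm2Sq g) := by
    linear_combination (2 * reDigammaQuarter T) * hT
  linarith

/-! ### Assembly -/

/-- **Sharp form.** For a Weil test `g` with `0 < ‖g‖₁` and `2‖g‖₁² ≤ π‖g‖₂²`:
`Re W_∞(g ⋆ g̃) ≥ ‖g‖₂² (log(‖g‖₂²/(2‖g‖₁²)) − 1) − ‖g‖₁²`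
(`Re W_∞(g ⋆ g̃) = (1/2π) ∫ G ρ − ‖g‖₂² log π`, the bathtub comparison at `T = π‖g‖₂²/‖g‖₁² ≥ 2`
and `∫_{−T}^{T} ρ ≥ 2T(log(T/2) − 1) − 2π`). [folklore] -/
theorem archBathtub_sharp {g : ℝ → ℂ} (hg : IsWeilTest g) (hL : 0 < weilNorm1 g)
    (hcond : 2 * weilNorm1 g ^ 2 ≤ Real.pi * weilNorm2Sq g) :
    weilNorm2Sq g * (Real.log (weilNorm2Sq g / (2 * weilNorm1 g ^ 2)) - 1) - weilNorm1 g ^ 2 ≤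
      (weilArchTerm (weilConv g (weilReflect g))).re := by
  set N := weilNorm2Sq g with hN
  set L := weilNorm1 g with hL'
  have hπ : 0 < Real.pi := Real.pi_pos
  have hL2 : 0 < L ^ 2 := by positivity
  have hN0 : 0 < N := pos_of_mul_pos_right (by linarith : 0 < Real.pi * N) hπ.le
  set T : ℝ := Real.pi * N / L ^ 2 with hT
  have hLT : L ^ 2 * T = Real.pi * N := by rw [hT]; field_simp
  have hT2 : 2 ≤ T := by rw [hT, le_div_iff₀ hL2]; linarith
  set A : ℝ := ∫ u : ℝ, ‖weilMellin g (1 / 2 + u * I)‖ ^ 2 * reDigammaQuarter u with hA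
  -- Step 1: the archimedean term of `g ⋆ g̃` is `(1/2π) A − N log π`
  have hA' : (∫ t : ℝ, ‖weilMellin g (1 / 2 + t * I)‖ ^ 2 *
      (Complex.digamma (1 / 4 + t / 2 * I)).re) = A := rfl
  have harch : (weilArchTerm (weilConv g (weilReflect g))).re =
      1 / (2 * Real.pi) * A - N * Real.log Real.pi := by
    have e : weilArchTerm (weilConv g (weilReflect g)) =
        ((1 / (2 * Real.pi) * A - N * Real.log Real.pi : ℝ) : ℂ) := by
      unfold weilArchTerm
      rw [weilArchIntegral_weilConv_weilReflect hg, weilConv_weilReflect_apply_zero, hA',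
        show (∫ t : ℝ, ‖g t‖ ^ 2) = N from rfl]
      push_cast
      ring
    rw [e, Complex.ofReal_re]
  -- Step 2: bathtub comparison `L² ∫_{-T}^{T} ρ ≤ A`
  have hbath : L ^ 2 * ∫ u in (-T)..T, reDigammaQuarter u ≤ A := bathtub hg (by linarith) hLT
  -- Step 3: the explicit digamma integral bound
  have hdig := integral_reDigammaQuarter_ge hT2
  -- Step 4: assembly
  have hmono : 1 / (2 * Real.pi) * (L ^ 2 * (2 * T * (Real.log (T / 2) - 1) - 2 * Real.pi)) ≤
      1 / (2 * Real.pi) * A := by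
    refine mul_le_mul_of_nonneg_left ?_ (by positivity)
    exact (mul_le_mul_of_nonneg_left hdig hL2.le).trans hbath
  have hq : 0 < N / (2 * L ^ 2) := by positivity
  have hlog : Real.log (T / 2) = Real.log Real.pi + Real.log (N / (2 * L ^ 2)) := by
    rw [← Real.log_mul hπ.ne' hq.ne']
    congr 1
    rw [hT]
    field_simp
  have key : 1 / (2 * Real.pi) * (L ^ 2 * (2 * T * (Real.log (T / 2) - 1) - 2 * Real.pi)) =
      N * (Real.log (T / 2) - 1) - L ^ 2 := by
    have e1 : L ^ 2 * (2 * T * (Real.log (T / 2) - 1) - 2 * Real.pi) =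
        2 * Real.pi * (N * (Real.log (T / 2) - 1) - L ^ 2) := by
      linear_combination (2 * (Real.log (T / 2) - 1)) * hLT
    rw [e1]
    field_simp
  rw [hlog] at key hmono
  rw [harch]
  linarith

/-! ### The stub -/

/-- **Stub `stub_archBathtub` — bathtub bound for the archimedean diagonal of a Weil test.** For a
Weil test `g` with `0 < ‖g‖₁` and `2‖g‖₁² ≤ π‖g‖₂²`:
`Re W_∞(g ⋆ g̃) ≥ ‖g‖₂² (log(‖g‖₂²/(2‖g‖₁²)) − 1) − (21/(5π)) ‖g‖₁²`
(from `archBathtub_sharp` and `1 ≤ 21/(5π)`). [folklore] -/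
theorem stub_archBathtub : ∀ g : ℝ → ℂ, IsWeilTest g → 0 < weilNorm1 g →
    2 * weilNorm1 g ^ 2 ≤ Real.pi * weilNorm2Sq g →
    weilNorm2Sq g * (Real.log (weilNorm2Sq g / (2 * weilNorm1 g ^ 2)) - 1) -
        21 / (5 * Real.pi) * weilNorm1 g ^ 2 ≤
      (weilArchTerm (weilConv g (weilReflect g))).re := by
  intro g hg hL hcond
  have h := archBathtub_sharp hg hL hcond
  have hπ : 0 < Real.pi := Real.pi_pos
  have hc : (1 : ℝ) ≤ 21 / (5 * Real.pi) := by
    rw [le_div_iff₀ (by positivity)]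
    linarith [Real.pi_le_four]
  have hL2 : 0 ≤ weilNorm1 g ^ 2 := sq_nonneg _
  nlinarith [mul_le_mul_of_nonneg_right hc hL2]

end Summit.RiemannHypothesis.RiemannHypothesis.Theorems.WeilCombBohrFejerMonotoneK2

end
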